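import Mathlib
import HarnessLib

/-!
# The half subgroup `⟨a⟩ ∪ ⟨a⟩s` of a group of order `32`, and fourth powers under a unique central involution

COR-CM (cell `pub-hodgecm2`), binder seat b04 (gen 37), count-neutral own lane «Galois-CM-type classification».  KERNEL ONLY:
theorems; no definition, no named fact, no `sorry`.  Pure group theory for «case A» of the ORDER-`32` BASE programme
(A7-JUNCTION gen-36 addendum §F–§G, gen-37 addendum).  `|G| = 32`, `a` of order `8`, `s ∉ ⟨a⟩` with `s a = a^μ s` and
`s² ∈ ⟨a⟩`: the sixteen elements `aⁱ sʲ` form a subgroup of index `2` (`exists_half_subgroup`), hence a normal one; this is the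
counting device behind the case-A driver.  Application (§3): if `c` is the only central involution of `G` and `G` has exponent
`≤ 8`, then `g⁴ ∈ {1, c}` for every `g` (`pow_four_eq_one_or_eq`): an element `g` of order `8` with `g⁴ = u ≠ c` would have the
half subgroup `⟨g⟩ × ⟨c⟩` inside `C(u)`, and a conjugate `x g x⁻¹ = gⁱ cʲ` with `x u x⁻¹ = g^{4i} ∈ {1, u}` — so `x ∈ C(u)` for all
`x`, i.e. `u` central.

## References

* [Rotman1995] J. J. Rotman, *An Introduction to the Theory of Groups*, 4th ed., GTM 148, Ch. 4 (Ex. 4.4) and Ch. 5.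

Provenance: Literature home (family `hodge`, namespace `Literature.GroupTheory.TwoGroupHalfSubgroup`) of the Summits-side `CorCM/TwoGroupHalfSubgroup` (cell `pub-hodgecm2`, COR-CM; all its imports are `Literature/` and Mathlib), which `Literature/` may not import; theorems only, no named fact, no definition. Nothing here bears on `HC_CM`. Lane `lit-hodgefound` (Layer A3: CM types, their Kubota ranks and Galois combinatorics), seat p20.
-/

namespace Literature.GroupTheory.TwoGroupHalfSubgroup

variable {G : Type*} [Group G]

/-! ## §1 Collection in `⟨a⟩ ∪ ⟨a⟩s` -/

/-- `s a = a^μ s` ⟹ `s aⁿ = a^{μ n} s`. [cite: Rotman1995, Ch. 4 Ex. 4.4] -/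
theorem semi_pow {a s : G} {μ : ℕ} (hsa : s * a = a ^ μ * s) (n : ℕ) : s * a ^ n = a ^ (μ * n) * s := by
  induction n with
  | zero => simp
  | succ n ih =>
    rw [pow_succ, ← mul_assoc, ih, mul_assoc, hsa, ← mul_assoc, ← pow_add, Nat.mul_succ]

/-- `s a = a^μ s` ⟹ `sʲ aⁿ = a^{μ^j n} sʲ`. [cite: Rotman1995, Ch. 4 Ex. 4.4] -/
theorem semi_pow_pow {a s : G} {μ : ℕ} (hsa : s * a = a ^ μ * s) (j n : ℕ) : s ^ j * a ^ n = a ^ (μ ^ j * n) * s ^ j := by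
  induction j generalizing n with
  | zero => simp
  | succ j ih =>
    rw [pow_succ, mul_assoc, semi_pow hsa, ← mul_assoc, ih, mul_assoc, show μ ^ j * (μ * n) = μ ^ (j + 1) * n by ring]

/-- **Products of normal forms**: `(aⁱ sʲ)(aᵏ sˡ)` is again some `a^{i'} s^{j'}` with `j' < 2` (`s² = aᵐ`). [cite: Rotman1995, Ch. 4 Ex. 4.4] -/
theorem semi_mul {a s : G} {μ m : ℕ} (hsa : s * a = a ^ μ * s) (hss : s * s = a ^ m) (i j k l : ℕ) (hj : j < 2)
    (hl : l < 2) : ∃ i' j' : ℕ, j' < 2 ∧ a ^ i * s ^ j * (a ^ k * s ^ l) = a ^ i' * s ^ j' := by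
  rcases (by omega : j = 0 ∨ j = 1) with rfl | rfl <;> rcases (by omega : l = 0 ∨ l = 1) with rfl | rfl
  · refine ⟨i + k, 0, by omega, ?_⟩
    simp only [pow_zero, mul_one]
    rw [pow_add]
  · refine ⟨i + k, 1, by omega, ?_⟩
    simp only [pow_zero, mul_one, pow_one]
    rw [pow_add, mul_assoc]
  · refine ⟨i + μ * k, 1, by omega, ?_⟩
    simp only [pow_zero, mul_one, pow_one]
    rw [mul_assoc, semi_pow hsa, ← mul_assoc, ← pow_add]
  · refine ⟨i + μ * k + m, 0, by omega, ?_⟩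
    simp only [pow_one, pow_zero, mul_one]
    rw [← mul_assoc, mul_assoc (a ^ i), semi_pow hsa, ← mul_assoc, ← pow_add, mul_assoc, hss, ← pow_add]

/-- `(i, j) ↦ aⁱ sʲ` is injective on `ℤ/8 × 𝔽₂` when `orderOf a = 8` and `s ∉ ⟨a⟩`. [cite: Rotman1995, Ch. 4 Ex. 4.4] -/
theorem words_injective {a s : G} (ha : orderOf a = 8) (hs : s ∉ Subgroup.zpowers a) :
    Function.Injective fun p : ZMod 8 × ZMod 2 => a ^ p.1.val * s ^ p.2.val := by
  have hs' : ∀ i i' : ℕ, a ^ i * s = a ^ i' → False := by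
    intro i i' h
    apply hs
    have : s = (a ^ i)⁻¹ * a ^ i' := by rw [← h, inv_mul_cancel_left]
    rw [this]
    exact Subgroup.mul_mem _ (Subgroup.inv_mem _ (Subgroup.pow_mem _ (Subgroup.mem_zpowers a) i))
      (Subgroup.pow_mem _ (Subgroup.mem_zpowers a) i')
  have hi : ∀ {i i' : ZMod 8}, a ^ i.val = a ^ i'.val → i = i' := by
    intro i i' h
    rw [pow_inj_mod, ha, Nat.mod_eq_of_lt (ZMod.val_lt i), Nat.mod_eq_of_lt (ZMod.val_lt i')] at h
    exact ZMod.val_injective 8 h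
  have h2 : ∀ j : ZMod 2, j = 0 ∨ j = 1 := by decide
  rintro ⟨i, j⟩ ⟨i', j'⟩ h
  simp only at h
  rcases h2 j with rfl | rfl <;> rcases h2 j' with rfl | rfl
  · simp only [ZMod.val_zero, pow_zero, mul_one] at h
    rw [hi h]
  · simp only [ZMod.val_zero, pow_zero, mul_one, show (1 : ZMod 2).val = 1 from rfl, pow_one] at h
    exact (hs' _ _ h.symm).elim
  · simp only [ZMod.val_zero, pow_zero, mul_one, show (1 : ZMod 2).val = 1 from rfl, pow_one] at h
    exact (hs' _ _ h).elim
  · simp only [show (1 : ZMod 2).val = 1 from rfl, pow_one] at h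
    rw [hi (mul_right_cancel h)]

/-! ## §2 The half subgroup -/

variable [Finite G]

/-- **The half subgroup.**  `|G| = 32`, `orderOf a = 8`, `s ∉ ⟨a⟩`, `s a = a^μ s`, `s² = aᵐ`: the elements `aⁱ sʲ` (`j < 2`)
form a subgroup of index `2`. [cite: Rotman1995, Ch. 4 Ex. 4.4] -/
theorem exists_half_subgroup (hcard : Nat.card G = 32) {a s : G} (ha : orderOf a = 8) (hs : s ∉ Subgroup.zpowers a)
    {μ m : ℕ} (hsa : s * a = a ^ μ * s) (hss : s * s = a ^ m) :
    ∃ H : Subgroup G, H.index = 2 ∧ ∀ g : G, g ∈ H ↔ ∃ i j : ℕ, j < 2 ∧ g = a ^ i * s ^ j := by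
  classical
  have hmul : ∀ {x y : G}, (∃ i j : ℕ, j < 2 ∧ x = a ^ i * s ^ j) → (∃ i j : ℕ, j < 2 ∧ y = a ^ i * s ^ j) →
      ∃ i j : ℕ, j < 2 ∧ x * y = a ^ i * s ^ j := by
    rintro x y ⟨i, j, hj, rfl⟩ ⟨k, l, hl, rfl⟩
    obtain ⟨i', j', hj', h⟩ := semi_mul hsa hss i j k l hj hl
    exact ⟨i', j', hj', h⟩
  have hone : ∃ i j : ℕ, j < 2 ∧ (1 : G) = a ^ i * s ^ j := ⟨0, 0, by omega, by simp⟩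
  have hpow : ∀ {x : G}, (∃ i j : ℕ, j < 2 ∧ x = a ^ i * s ^ j) → ∀ n : ℕ, ∃ i j : ℕ, j < 2 ∧ x ^ n = a ^ i * s ^ j := by
    intro x hx n
    induction n with
    | zero => rw [pow_zero]; exact hone
    | succ n ih => rw [pow_succ]; exact hmul ih hx
  let H : Subgroup G :=
    { carrier := {g | ∃ i j : ℕ, j < 2 ∧ g = a ^ i * s ^ j}
      mul_mem' := fun hx hy => hmul hx hy
      one_mem' := hone
      inv_mem' := fun {x} hx => by
        have h := hpow hx (orderOf x - 1)
        have hinv : x ^ (orderOf x - 1) = x⁻¹ := by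
          rw [eq_inv_iff_mul_eq_one, ← pow_succ, Nat.sub_add_cancel (orderOf_pos x), pow_orderOf_eq_one]
        rwa [hinv] at h }
  refine ⟨H, ?_, fun g => Iff.rfl⟩
  -- `|H| = 16`
  have hmemH : ∀ g : G, g ∈ H ↔ ∃ i j : ℕ, j < 2 ∧ g = a ^ i * s ^ j := fun g => Iff.rfl
  let f : ZMod 8 × ZMod 2 → H := fun p => ⟨a ^ p.1.val * s ^ p.2.val, (hmemH _).2 ⟨p.1.val, p.2.val, ZMod.val_lt _, rfl⟩⟩
  have hinj : Function.Injective f := by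
    intro p q h
    exact words_injective ha hs (congrArg Subtype.val h)
  have hsurj : Function.Surjective f := by
    rintro ⟨g, hg⟩
    obtain ⟨i, j, hj, rfl⟩ := (hmemH g).1 hg
    refine ⟨((i : ZMod 8), (j : ZMod 2)), Subtype.ext ?_⟩
    simp only [f]
    rw [ZMod.val_natCast, ZMod.val_natCast, Nat.mod_eq_of_lt hj, ← ha, pow_mod_orderOf]
  have hcardH : Nat.card H = 16 := by
    rw [← Nat.card_eq_of_bijective f ⟨hinj, hsurj⟩, Nat.card_prod, Nat.card_zmod, Nat.card_zmod]
  have h := H.card_mul_index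
  rw [hcardH, hcard] at h
  omega

/-! ## §3 Fourth powers under a unique central involution -/

omit [Finite G] in
/-- The involution of `⟨g⟩` (`orderOf g = 8`) is `g⁴`: an involution `s ≠ g⁴` is not a power of `g`. [cite: Rotman1995, Ch. 4 Ex. 4.4] -/
theorem not_mem_zpowers_of_involution {g s : G} (hg : orderOf g = 8) (hss : s * s = 1) (hs1 : s ≠ 1) (hs4 : s ≠ g ^ 4) :
    s ∉ Subgroup.zpowers g := by
  intro hmem
  rw [Subgroup.mem_zpowers_iff] at hmem
  obtain ⟨k, hk⟩ := hmem
  have h2k : g ^ (2 * k) = 1 := by rw [mul_comm, zpow_mul, hk, zpow_two, hss]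
  have hd : (8 : ℤ) ∣ 2 * k := by
    have := orderOf_dvd_iff_zpow_eq_one.2 h2k
    rw [hg] at this
    exact_mod_cast this
  obtain ⟨q, hq⟩ := hd
  have hk' : k = 4 * q := by omega
  have hg8 : g ^ (8 : ℤ) = 1 := by
    rw [show (8 : ℤ) = ((8 : ℕ) : ℤ) by norm_num, zpow_natCast, ← hg, pow_orderOf_eq_one]
  rcases Int.even_or_odd' q with ⟨r, hr | hr⟩
  · apply hs1
    rw [← hk, hk', hr, show (4 : ℤ) * (2 * r) = 8 * r by ring, zpow_mul, hg8, one_zpow]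
  · apply hs4
    rw [← hk, hk', hr, show (4 : ℤ) * (2 * r + 1) = 8 * r + 4 by ring, zpow_add, zpow_mul, hg8, one_zpow, one_mul]
    exact zpow_ofNat g 4

/-- **`g⁴ ∈ {1, c}`.**  `|G| = 32`, `c ≠ 1` a central involution which is the ONLY central involution, and `g⁸ = 1` for all
`g` (no element of order `16`).  Then every `g⁴` is `1` or `c`: otherwise `u = g⁴` is a non-central involution, the half
subgroup `⟨g⟩ × ⟨c⟩` is normal, so `x g x⁻¹ = gⁱ cʲ` and `x u x⁻¹ = g^{4i} ∈ {1, u}` for every `x` — `u` would be central.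
[cite: Rotman1995, Ch. 4 Ex. 4.4] -/
theorem pow_four_eq_one_or_eq (hcard : Nat.card G = 32) {c : G} (hcc : c * c = 1) (hc1 : c ≠ 1)
    (hcen : ∀ g : G, c * g = g * c)
    (huci : ∀ s : G, s * s = 1 → (∀ g : G, g * s = s * g) → s = 1 ∨ s = c) (hexp : ∀ g : G, g ^ 8 = 1) (g : G) :
    g ^ 4 = 1 ∨ g ^ 4 = c := by
  classical
  by_contra h
  push Not at h
  obtain ⟨h1, hc⟩ := h
  have huu : g ^ 4 * g ^ 4 = 1 := by rw [← pow_add]; exact hexp g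
  -- `u = g⁴` is not central
  have hnc : ∃ x : G, x * g ^ 4 ≠ g ^ 4 * x := by
    by_contra hall
    push Not at hall
    rcases huci (g ^ 4) huu hall with h | h
    · exact h1 h
    · exact hc h
  obtain ⟨x, hx⟩ := hnc
  have hg8 : orderOf g = 8 := by
    have h := orderOf_eq_prime_pow (p := 2) (n := 2) (by simpa using h1) (by simpa using hexp g)
    simpa using h
  have hcg : c ∉ Subgroup.zpowers g := not_mem_zpowers_of_involution hg8 hcc hc1 (Ne.symm hc)
  obtain ⟨H, hidx, hmem⟩ := exists_half_subgroup hcard hg8 hcg (μ := 1) (m := 0)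
    (by rw [pow_one]; exact hcen g) (by rw [pow_zero]; exact hcc)
  haveI hN := Subgroup.normal_of_index_eq_two hidx
  have hgH : g ∈ H := (hmem g).2 ⟨1, 0, by omega, by simp⟩
  obtain ⟨i, j, -, hij⟩ := (hmem _).1 (hN.conj_mem g hgH x)
  -- `x u x⁻¹ = (x g x⁻¹)⁴ = g^{4i}`
  have hcomm : Commute g c := (hcen g).symm
  have h4 : x * g ^ 4 * x⁻¹ = g ^ (4 * i) := by
    rw [← conj_pow, hij, (hcomm.pow_pow i j).mul_pow, ← pow_mul, ← pow_mul, mul_comm i 4, mul_comm j 4, pow_mul c,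
      show c ^ 4 = 1 by rw [show (4 : ℕ) = 2 + 2 from rfl, pow_add, pow_two, hcc, one_mul], one_pow, mul_one]
  rcases Nat.even_or_odd i with ⟨r, hr⟩ | ⟨r, hr⟩
  · -- `i` even: `x u x⁻¹ = 1`
    apply h1
    rw [hr, show 4 * (r + r) = 8 * r by ring, pow_mul, hexp g, one_pow, mul_inv_eq_one] at h4
    have : x * g ^ 4 = x * 1 := by rw [mul_one]; exact h4
    exact mul_left_cancel this
  · -- `i` odd: `x u x⁻¹ = u`
    apply hx
    rw [hr, show 4 * (2 * r + 1) = 8 * r + 4 by ring, pow_add, pow_mul, hexp g, one_pow, one_mul,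
      mul_inv_eq_iff_eq_mul] at h4
    exact h4

/-! ## §4 An involution commuting with an element of order `8` has at most two conjugates -/

omit [Finite G] in
/-- `orderOf a = 8`, `(aⁱ)² = 1` ⟹ `aⁱ ∈ {1, a⁴}`. [cite: Rotman1995, Ch. 4 Ex. 4.4] -/
theorem pow_eq_one_or_eq_pow_four {a : G} (ha : orderOf a = 8) {i : ℕ} (h : a ^ i * a ^ i = 1) :
    a ^ i = 1 ∨ a ^ i = a ^ 4 := by
  have ha8 : a ^ 8 = 1 := by rw [← ha]; exact pow_orderOf_eq_one a
  have hd : 8 ∣ 2 * i := by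
    rw [← ha]
    exact orderOf_dvd_of_pow_eq_one (by rw [mul_comm, pow_mul, pow_two, h])
  obtain ⟨q, hq⟩ := hd
  have hi : i = 4 * q := by omega
  rcases Nat.even_or_odd q with ⟨r, hr⟩ | ⟨r, hr⟩
  · left
    rw [hi, hr, show 4 * (r + r) = 8 * r by ring, pow_mul, ha8, one_pow]
  · right
    rw [hi, hr, show 4 * (2 * r + 1) = 8 * r + 4 by ring, pow_add, pow_mul, ha8, one_pow, one_mul]

/-- **Two conjugates.**  `|G| = 32`, `orderOf a = 8`, `t ∉ {1, a⁴}` an involution commuting with `a`.  Then every conjugate of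
`t` is `t` or `t a⁴` (the half subgroup `⟨a⟩ × ⟨t⟩` is normal, and its involutions are `a⁴, t, t a⁴`; a conjugate `a⁴` of `t`
would make `t = (g⁻¹ a g)⁴ ∈ {1, a⁴}`). [cite: Rotman1995, Ch. 4 Ex. 4.4] -/
theorem conj_involution_of_comm (hcard : Nat.card G = 32) {a t : G} (ha : orderOf a = 8) (htt : t * t = 1) (ht1 : t ≠ 1)
    (ht4 : t ≠ a ^ 4) (hat : a * t = t * a) (g : G) : g * t * g⁻¹ = t ∨ g * t * g⁻¹ = t * a ^ 4 := by
  classical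
  have ha8 : a ^ 8 = 1 := by rw [← ha]; exact pow_orderOf_eq_one a
  have hta : t ∉ Subgroup.zpowers a := not_mem_zpowers_of_involution ha htt ht1 ht4
  obtain ⟨H, hidx, hmem⟩ := exists_half_subgroup hcard ha hta (μ := 1) (m := 0)
    (by rw [pow_one]; exact hat.symm) (by rw [pow_zero]; exact htt)
  haveI hN := Subgroup.normal_of_index_eq_two hidx
  have htH : t ∈ H := (hmem t).2 ⟨0, 1, by omega, by simp⟩
  have haH : a ∈ H := (hmem a).2 ⟨1, 0, by omega, by simp⟩
  obtain ⟨i, j, hj, hij⟩ := (hmem _).1 (hN.conj_mem t htH g)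
  have hcomm : Commute a t := hat
  have hsq : (g * t * g⁻¹) * (g * t * g⁻¹) = 1 := by
    rw [show g * t * g⁻¹ * (g * t * g⁻¹) = g * (t * t) * g⁻¹ by group, htt]; group
  rcases (by omega : j = 0 ∨ j = 1) with rfl | rfl
  · -- `g t g⁻¹ = aⁱ`, an involution of `⟨a⟩`: it is `a⁴`, and then `t = (g⁻¹ a g)⁴ ∈ {1, a⁴}`
    exfalso
    rw [pow_zero, mul_one] at hij
    rw [hij] at hsq
    rcases pow_eq_one_or_eq_pow_four ha hsq with h | h
    · rw [h, mul_inv_eq_one] at hij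
      exact ht1 (mul_left_cancel (hij.trans (mul_one g).symm))
    · rw [h] at hij
      -- `g⁻¹ a g = aᵏ tˡ`, so `t = g⁻¹ a⁴ g = a^{4k}`
      obtain ⟨k, l, hl, hkl⟩ := (hmem _).1 (hN.conj_mem a haH g⁻¹)
      rw [inv_inv] at hkl
      have ht : t = (g⁻¹ * a * g) ^ 4 := by
        rw [show g⁻¹ * a * g = g⁻¹ * a * g⁻¹⁻¹ by rw [inv_inv], conj_pow, ← hij]; group
      rw [hkl, (hcomm.pow_pow k l).mul_pow, ← pow_mul t, mul_comm l 4, pow_mul t, show t ^ 4 = 1 by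
        rw [show (4 : ℕ) = 2 + 2 from rfl, pow_add, pow_two, htt, one_mul], one_pow, mul_one, ← pow_mul] at ht
      have hsq' : a ^ (k * 4) * a ^ (k * 4) = 1 := by rw [← ht, htt]
      rcases pow_eq_one_or_eq_pow_four ha hsq' with h' | h'
      · exact ht1 (ht.trans h')
      · exact ht4 (ht.trans h')
  · rw [pow_one] at hij
    have hsq' : a ^ i * a ^ i = 1 := by
      rw [hij, show a ^ i * t * (a ^ i * t) = a ^ i * a ^ i * (t * t) by
        rw [mul_assoc, ← mul_assoc t, ← (hcomm.pow_left i).eq]; group, htt, mul_one] at hsq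
      exact hsq
    rcases pow_eq_one_or_eq_pow_four ha hsq' with h | h
    · left; rw [hij, h, one_mul]
    · right; rw [hij, h, (hcomm.pow_left 4).eq]

end Literature.GroupTheory.TwoGroupHalfSubgroup
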